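import Summits.HodgeConjecture.CorCM.DihedralReflexSwapReflect
import HarnessLib

/-!
# The dihedral surface triple, I: vertex–edge duality — the swap of a CM type of the reflex-class field `M` fixes an
# antipodal pair of embeddings of `K`, with the same stabiliser

COR-CM (cell `pub-hodgecm2`, seat p2 gen 19, count-neutral claim DIHEDRAL-TRIPLE, file 1 of 3); NEW as stated, hence
under `Summits/`.  Theorems only; no definition, no named fact, no `sorry`.  Consumed by `DihedralReflexTripleCMHodge`
(the triple `S₁ × S₂ × S₁′` of pairwise non-isogenous simple CM abelian surfaces inside one dihedral octic CM field
carries an exceptional Hodge class of type `(2,2)` on the triple ITSELF).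

THE SITUATION (as in `DihedralReflexSwapReflect`).  `K` is a quartic CM field which is NOT Galois over `ℚ` (Galois
closure `L ⊂ ℂ` dihedral of order `8`), `M` a quartic CM field with `Hom(M, ℂ)` landing in `L`, `Hom(M, K) = ∅`, and
(for the existence statements) `M/ℚ` not Galois.  A CM type `Ψ = {u, v}` of `M` (`v ∉ {u, ū}`) is an EDGE of the
square `Hom(M, ℂ) = {u, v, ū, v̄}`; the embeddings of `K` are the vertices of the other square.  The dihedral group is
never named: everything goes through the action of `Aut(ℂ)` on embeddings by composition.

* `exists_swap` — some `σ ∈ Aut(ℂ)` swaps `u` and `v` (`σ = τσ₀`, Shimura's `4`-cycle and reflection of `M`).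
* `normalClosure_eq_normalClosure`, `apply_mem_normalClosure_partner` — `L_M = L_K` (both octic), so transfer of
  identities between automorphisms works in both directions (`DihedralReflexPair.smul_eq_smul_of_forall_smul_eq`).
* **`exists_smul_eq_self_of_swap`** — a swap `σ` of `{u, v}` FIXES some embedding `q` of `K` (hence the antipodal pair
  `{q, q̄}`): on `Hom(K, ℂ) = {a, ā, b, b̄}`, `σa = ā` forces `σb = b` (else `σ` is complex conjugation on `L`,
  `σu = ū ≠ v`); `σa = b, σb = ā` makes `σ²` complex conjugation (`σσu = u`); `σa = b, σb = a` makes `σ` the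
  swap–reflection `DihedralReflexPair.exists_swap_reflect`, which fixes an embedding of `M` — but `σ` moves all four.
* **`smul_eq_self_iff_of_swap`** — THE STABILISERS AGREE: `γq = q ⟺ (γu, γv) ∈ {(u, v), (v, u)}` for every
  `γ ∈ Aut(ℂ)`.  In `D₄`: an edge reflection of one square is a vertex reflection of the other, and the vertices of one
  square are (equivariantly) the edges of the other.

## References
* [Shimura1998] G. Shimura, *Abelian Varieties with Complex Multiplication and Modular Functions*, §8.4 Example (2)(C).
* [MoonenZarhin1999LowDim] B. Moonen, Yu. Zarhin, *Hodge classes on abelian varieties of low dimension*, Math. Ann. 315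
  (1999) 711–733, "Hodge groups of simple abelian surfaces of CM-type".
-/

noncomputable section

open CategoryTheory CategoryTheory.Limits NumberField NumberField.ComplexEmbedding IntermediateField
open scoped BigOperators

namespace Summit.HodgeConjecture.CorCM

open Literature.NumberTheory.ComplexMultiplication
open Literature.AlgebraicGeometry.Motives (CMType)
open Literature.AlgebraicGeometry.Pohlmann1968
open QuarticCM DihedralReflexPair

namespace DihedralReflexTriple

/-! ### §1 Vertex–edge duality: the swap of an edge of `Hom(M, ℂ)` fixes an antipodal pair of `Hom(K, ℂ)` -/

section TwoFields

variable {K M : Type} [Field K] [NumberField K] [IsCMField K] [Field M] [NumberField M] [IsCMField M]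

/-- **The swap of an edge.**  For a non-Galois quartic CM field `M` and embeddings `v ∉ {u, ū}`, some `σ ∈ Aut(ℂ)` has
`σ ∘ u = v` and `σ ∘ v = u`: `σ = τσ₀` with Shimura's `4`-cycle `τ` (`u ↦ v ↦ ū`) and reflection `σ₀` (`u ↦ u`,
`v ↦ v̄`). [cite: Shimura1998, §8.4 Example (2)(C)] -/
theorem exists_swap (h4 : Module.finrank ℚ M = 4) (hM : ¬IsGalois ℚ M) {u v : M →+* ℂ} (hvu : v ≠ u)
    (hvu' : v ≠ conjugate u) : ∃ σ : ℂ ≃+* ℂ, σ • u = v ∧ σ • v = u := by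
  obtain ⟨τ, hτu, hτv⟩ := exists_ringAut_smul_eq_smul_eq_conjugate h4 hM hvu hvu'
  obtain ⟨σ₀, hσu, hσv⟩ := exists_ringAut_smul_eq_self_smul_eq_conjugate_of_not_isGalois h4 hM hvu hvu'
  refine ⟨τ * σ₀, ?_, ?_⟩
  · rw [mul_smul, hσu, hτu]
  · rw [mul_smul, hσv, smul_conjugate, hτv, involutive_conjugate]

/-- The Galois closures in `ℂ` of `K` and of a partner `M` of the same degree `8` whose embeddings land in that of `K`
coincide. [cite: Shimura1998, §8.4 Example (2)(C)] -/
theorem normalClosure_eq_normalClosure (h4K : Module.finrank ℚ K = 4) (hK : ¬IsGalois ℚ K)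
    (h4M : Module.finrank ℚ M = 4) (hM : ¬IsGalois ℚ M)
    (hMK : ∀ (t : M →+* ℂ) (y : M), t y ∈ normalClosure ℚ K ℂ) :
    normalClosure ℚ M ℂ = normalClosure ℚ K ℂ := by
  have hle : normalClosure ℚ M ℂ ≤ normalClosure ℚ K ℂ := by
    refine normalClosure_le_iff.2 fun f => ?_
    rintro _ ⟨y, rfl⟩
    exact hMK f.toRingHom y
  exact IntermediateField.eq_of_le_of_finrank_eq hle
    (by rw [finrank_normalClosure_eq_eight h4M hM, finrank_normalClosure_eq_eight h4K hK])

/-- Hence the embeddings of `K` land in the Galois closure of `M` (transfer in the other direction).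
[cite: Shimura1998, §8.4 Example (2)(C)] -/
theorem apply_mem_normalClosure_partner (h4K : Module.finrank ℚ K = 4) (hK : ¬IsGalois ℚ K)
    (h4M : Module.finrank ℚ M = 4) (hM : ¬IsGalois ℚ M)
    (hMK : ∀ (t : M →+* ℂ) (y : M), t y ∈ normalClosure ℚ K ℂ) (s : K →+* ℂ) (y : K) :
    s y ∈ normalClosure ℚ M ℂ := by
  rw [normalClosure_eq_normalClosure h4K hK h4M hM hMK]
  exact s.toRatAlgHom.fieldRange_le_normalClosure ⟨y, rfl⟩

/-- **The swap of an edge of `Hom(M, ℂ)` fixes an embedding of `K`.**  If `σ ∈ Aut(ℂ)` swaps `u, v` (`v ∉ {u, ū}`), then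
`σ ∘ q = q` for some `q : K → ℂ`.  Otherwise, on `Hom(K, ℂ) = {a, ā, b, b̄}`: `σa = ā` forces `σb = b` (if `σb = b̄` then
`σ` is complex conjugation on the closure, `σu = ū ≠ v`); `σa = b`, `σb = ā` makes `σ²` complex conjugation
(`σσu = u ≠ ū`); and `σa = b`, `σb = a` makes `σ` the swap–reflection of `DihedralReflexSwapReflect`, which fixes an
embedding of `M` — but `σ` moves all four.  (In `D₄`: an edge reflection of one square is a vertex reflection of the
other.) [cite: Shimura1998, §8.4 Example (2)(C)] [cite: MoonenZarhin1999LowDim, "Hodge groups of simple abelian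
surfaces of CM-type"] -/
theorem exists_smul_eq_self_of_swap (h4K : Module.finrank ℚ K = 4) (hK : ¬IsGalois ℚ K)
    (h4M : Module.finrank ℚ M = 4) (hMK : ∀ (t : M →+* ℂ) (y : M), t y ∈ normalClosure ℚ K ℂ)
    (hne : IsEmpty (M →+* K)) {u v : M →+* ℂ} (hvu : v ≠ u) (hvu' : v ≠ conjugate u) {σ : ℂ ≃+* ℂ}
    (hσu : σ • u = v) (hσv : σ • v = u) : ∃ q : K →+* ℂ, σ • q = q := by
  obtain ⟨a⟩ : Nonempty (K →+* ℂ) := inferInstance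
  -- `σ` moves every embedding of `M`
  have hmove : ∀ t : M →+* ℂ, σ • t ≠ t := by
    intro t ht
    rcases eq_or_eq_or_eq_or_eq h4M hvu hvu' t with rfl | rfl | rfl | rfl
    · exact hvu (hσu.symm.trans ht)
    · rw [smul_conjugate, hσu] at ht
      exact hvu ((involutive_conjugate M).injective ht)
    · exact hvu (ht.symm.trans hσv)
    · rw [smul_conjugate, hσv] at ht
      exact hvu ((involutive_conjugate M).injective ht).symm
  -- the case `σ a = b` with `b ∉ {a, ā}`
  have key : ∀ b : K →+* ℂ, b ≠ a → b ≠ conjugate a → σ • a = b → ∃ q : K →+* ℂ, σ • q = q := by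
    intro b hba hba' h
    rcases eq_or_eq_or_eq_or_eq h4K hba hba' (σ • b) with hb | hb | hb | hb
    · -- `σ` swaps `a, b`: it is the swap–reflection, which fixes an embedding of `M`
      exfalso
      obtain ⟨g, t₀, t₁, -, -, hga, hgb, hgt₀, -⟩ := exists_swap_reflect h4K hK h4M hMK hne hba hba'
      have hK' : ∀ s : K →+* ℂ, σ • s = g • s :=
        forall_smul_eq_of_pair h4K hba hba' (h.trans hga.symm) (hb.trans hgb.symm)
      exact hmove t₀ ((smul_eq_smul_of_forall_smul_eq hMK hK' t₀).trans hgt₀)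
    · -- `σ` is a `4`-cycle: `σ²` is complex conjugation
      exfalso
      have hK2 : ∀ s : K →+* ℂ, (σ * σ) • s = (starRingAut : ℂ ≃+* ℂ) • s := by
        refine forall_smul_eq_of_pair h4K hba hba' ?_ ?_
        · rw [mul_smul, h, hb, conj_smul_eq_conjugate]
        · rw [mul_smul, hb, smul_conjugate, h, conj_smul_eq_conjugate]
      have h2 := smul_eq_smul_of_forall_smul_eq hMK hK2 u
      rw [mul_smul, hσu, hσv, conj_smul_eq_conjugate] at h2
      exact conjugate_ne u h2.symm
    · exact absurd (smul_left_cancel σ (hb.trans h.symm)) hba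
    · have h' : σ • conjugate a = conjugate b := by rw [smul_conjugate, h]
      exact absurd (smul_left_cancel σ (hb.trans h'.symm)) hba'
  obtain ⟨b, hba, hba'⟩ := exists_ne_ne_conjugate h4K a
  have hab' : conjugate b ≠ a := fun h => hba' (by rw [← h, involutive_conjugate])
  have hcc : conjugate b ≠ conjugate a := fun h => hba ((involutive_conjugate K).injective h)
  rcases eq_or_eq_or_eq_or_eq h4K hba hba' (σ • a) with h | h | h | h
  · exact ⟨a, h⟩
  · -- `σ a = ā`: then `σ b = b`
    have hσa' : σ • conjugate a = a := by rw [smul_conjugate, h, involutive_conjugate]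
    rcases eq_or_eq_or_eq_or_eq h4K hba hba' (σ • b) with hb | hb | hb | hb
    · exact absurd (smul_left_cancel σ (hb.trans hσa'.symm)) hba'
    · exact absurd (smul_left_cancel σ (hb.trans h.symm)) hba
    · exact ⟨b, hb⟩
    · -- `σ` is complex conjugation on the closure: `σ u = ū ≠ v`
      exfalso
      have hKc : ∀ s : K →+* ℂ, σ • s = (starRingAut : ℂ ≃+* ℂ) • s := by
        refine forall_smul_eq_of_pair h4K hba hba' ?_ ?_
        · rw [h, conj_smul_eq_conjugate]
        · rw [hb, conj_smul_eq_conjugate]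
      have h2 := smul_eq_smul_of_forall_smul_eq hMK hKc u
      rw [hσu, conj_smul_eq_conjugate] at h2
      exact hvu' h2
  · exact key b hba hba' h
  · exact key (conjugate b) hab' hcc h

/-- **The stabilisers agree.**  With `σ` swapping the edge `{u, v}` of `Hom(M, ℂ)` and `q` an embedding of `K` fixed by
`σ`: an automorphism `γ` of `ℂ` fixes `q` iff it stabilises `{u, v}` (pointwise or by the swap).  For `γq = q`: `γ`
permutes the other pair `{o, ō}`; `γo = o` makes `γ` trivial on the closure, `γo = ō = σo` makes `γ = σ` there.
Conversely an automorphism fixing `u, v` (resp. acting as `σ` on them) is trivial (resp. `= σ`) on the closure.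
[cite: Shimura1998, §8.4 Example (2)(C)] -/
theorem smul_eq_self_iff_of_swap (h4K : Module.finrank ℚ K = 4) (h4M : Module.finrank ℚ M = 4)
    (hMK : ∀ (t : M →+* ℂ) (y : M), t y ∈ normalClosure ℚ K ℂ)
    (hKM : ∀ (s : K →+* ℂ) (y : K), s y ∈ normalClosure ℚ M ℂ) {u v : M →+* ℂ} (hvu : v ≠ u)
    (hvu' : v ≠ conjugate u) {σ : ℂ ≃+* ℂ} (hσu : σ • u = v) (hσv : σ • v = u) {q : K →+* ℂ} (hq : σ • q = q)
    (γ : ℂ ≃+* ℂ) : γ • q = q ↔ (γ • u = u ∧ γ • v = v) ∨ (γ • u = v ∧ γ • v = u) := by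
  obtain ⟨o, hoq, hoq'⟩ := exists_ne_ne_conjugate h4K q
  have hσq' : σ • conjugate q = conjugate q := by rw [smul_conjugate, hq]
  -- `σ o = ō`
  have hσo : σ • o = conjugate o := by
    rcases eq_or_eq_or_eq_or_eq h4K hoq hoq' (σ • o) with h | h | h | h
    · exact absurd (smul_left_cancel σ (h.trans hq.symm)) hoq
    · exact absurd (smul_left_cancel σ (h.trans hσq'.symm)) hoq'
    · exfalso
      have hK1 : ∀ s : K →+* ℂ, σ • s = (1 : ℂ ≃+* ℂ) • s :=
        forall_smul_eq_of_pair h4K hoq hoq' (by rw [hq, one_smul]) (by rw [h, one_smul])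
      have h1 := smul_eq_smul_of_forall_smul_eq hMK hK1 u
      rw [hσu, one_smul] at h1
      exact hvu h1
    · exact h
  constructor
  · intro hγ
    have hγq' : γ • conjugate q = conjugate q := by rw [smul_conjugate, hγ]
    rcases eq_or_eq_or_eq_or_eq h4K hoq hoq' (γ • o) with h | h | h | h
    · exact absurd (smul_left_cancel γ (h.trans hγ.symm)) hoq
    · exact absurd (smul_left_cancel γ (h.trans hγq'.symm)) hoq'
    · left
      have hK1 : ∀ s : K →+* ℂ, γ • s = (1 : ℂ ≃+* ℂ) • s :=
        forall_smul_eq_of_pair h4K hoq hoq' (by rw [hγ, one_smul]) (by rw [h, one_smul])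
      have hu := smul_eq_smul_of_forall_smul_eq hMK hK1 u
      have hv := smul_eq_smul_of_forall_smul_eq hMK hK1 v
      rw [one_smul] at hu hv
      exact ⟨hu, hv⟩
    · right
      have hKσ : ∀ s : K →+* ℂ, γ • s = σ • s :=
        forall_smul_eq_of_pair h4K hoq hoq' (hγ.trans hq.symm) (h.trans hσo.symm)
      exact ⟨(smul_eq_smul_of_forall_smul_eq hMK hKσ u).trans hσu,
        (smul_eq_smul_of_forall_smul_eq hMK hKσ v).trans hσv⟩
  · rintro (⟨hu, hv⟩ | ⟨hu, hv⟩)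
    · have hM1 : ∀ t : M →+* ℂ, γ • t = (1 : ℂ ≃+* ℂ) • t :=
        forall_smul_eq_of_pair h4M hvu hvu' (by rw [hu, one_smul]) (by rw [hv, one_smul])
      have h1 := smul_eq_smul_of_forall_smul_eq hKM hM1 q
      rwa [one_smul] at h1
    · have hMσ : ∀ t : M →+* ℂ, γ • t = σ • t :=
        forall_smul_eq_of_pair h4M hvu hvu' (hu.trans hσu.symm) (hv.trans hσv.symm)
      exact (smul_eq_smul_of_forall_smul_eq hKM hMσ q).trans hq

end TwoFields

end DihedralReflexTriple

end Summit.HodgeConjecture.CorCM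

end
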